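import Summits.ResolutionOfSingularities.ResolutionOfSingularities.Theorems.PAlterationPicoverMorseCharTwo
import Summits.ResolutionOfSingularities.ResolutionOfSingularities.Theorems.PAlterationPicoverLocalModelSingularLocus
import Literature.AlgebraicGeometry.Resolution.BlowupChartRegular
import Literature.AlgebraicGeometry.Resolution.QuadraticTransformsRegular
import HarnessLib

/-!
# Crux `Picover` (stmt-ResolutionOfSingularities-0554), line `degree-p-tower`:
# the strict-transform cover `(t/x_{i₀})² = g₁` over a blow-up chart of a char-`2` Morse point
# is regular along the exceptional divisor

Registered helper `isRegularLocalRing_cover_chart_of_morse_char_two` (second tooth of the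
Hirokado engine for `p = 2`). Setting: `(R, 𝔪, κ)` regular local of characteristic `2`, a regular
system of parameters `x` with dual derivations `D_i`, `g ∈ 𝔪²` with non-degenerate polar form,
`K = Frac R`, and the `x_{i₀}`-chart `R₁ = R[x_j / x_{i₀}] ⊆ K` of the blow-up of `𝔪`. Then
`g = x_{i₀}² g₁` with `g₁ ∈ R₁`, and the double cover `R₁[T]/(T² - g₁)` (the strict transform of
`t² = g`) is regular at every prime `P` lying over the exceptional divisor (`x_{i₀} ∈ P ∩ R₁`).

Proof. By `MorseCharTwo.morse_dies_in_one_blowup_char_two` (first tooth) some `ℤ`-derivation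
`D₁` of `R₁` has `D₁ g₁ ∉ 𝔮 = P ∩ R₁`; by `isRegularLocalRing_localModel_of_derivation` (the
pointwise Jacobian criterion for `tⁿ = a` over a regular ring) it remains to know that `R₁` is a
regular ring. This is Liu Thm. 8.1.19 (a) on the charts: `R₁` is the image in `K` of the chart
ring `(R[𝔪t])_{(x_{i₀} t)}` of the blow-up of the closed point
(`isRegularRing_closure_of_isRegularRing_blowupChart`, `Algebra.adjoin_eq_ring_closure`), which
is regular by `isRegularRing_blowupChart` (`x` is quasi-regular, `R` and `R/𝔪` are regular).
No statement item is restated.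
-/

set_option linter.dupNamespace false -- mandated namespace of this single-conjunct summit

universe u

namespace Summit.ResolutionOfSingularities.ResolutionOfSingularities.Theorems.Picover.MorseCharTwoCover

open IsLocalRing Polynomial
open Literature.AlgebraicGeometry.Resolution

/-- **The chart `R[x_j/x_{i₀}] ⊆ K` of the blow-up of the closed point of a regular local ring
is a regular ring** (Liu Thm. 8.1.19 (a) on the charts, in the field-embedded model: the chart
ring `(R[𝔪t])_{(x_{i₀}t)}` is regular by `isRegularRing_blowupChart` and maps isomorphically onto
the subring of `K` generated by `R` and the `x_j/x_{i₀}`, which is the subalgebra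
`Algebra.adjoin R {x_j/x_{i₀}}`). [cite: Liu2002, Thm. 8.1.19 (a) (affine charts)] -/
theorem isRegularRing_adjoin_chart {R : Type u} [CommRing R] [IsRegularLocalRing R] {d : ℕ}
    (x : Fin d → R) (hx : Ideal.span (Set.range x) = maximalIdeal R)
    (hdim : (d : WithBot ℕ∞) = ringKrullDim R) (K : Type u) [Field K] [Algebra R K]
    [IsFractionRing R K] (i₀ : Fin d) (hx0 : x i₀ ≠ 0) :
    IsRegularRing
      (Algebra.adjoin R (Set.range fun j : Fin d => algebraMap R K (x j) / algebraMap R K (x i₀))) := by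
  classical
  -- `d = emb dim R`
  have hd : (maximalIdeal R).spanFinrank = d := by
    have h := IsRegularLocalRing.spanFinrank_maximalIdeal (R := R)
    rw [← hdim] at h
    exact Nat.cast_injective (R := WithBot ℕ∞) h
  -- the chart ring of the blow-up of `𝔪 = (x)` at `x_{i₀}` is regular
  haveI : IsRegularRing R := isRegularRing_of_isRegularLocalRing R
  haveI : IsRegularRing (R ⧸ Ideal.span (Set.range x)) := by
    have hreg : IsRegularLocalRing
        (R ⧸ Ideal.span (x '' ((Finset.univ : Finset (Fin d)) : Set (Fin d)))) :=
      isRegularLocalRing_quotient_span_image hd x hx Finset.univ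
    rw [Finset.coe_univ, Set.image_univ] at hreg
    exact isRegularRing_of_isRegularLocalRing _
  have hB := isRegularRing_blowupChart x i₀ (isQuasiRegular_regularSystemOfParameters hd x hx)
  -- its image in `K` is the subring generated by `R` and the `x_j / x_{i₀}`
  have hx0' : algebraMap R K (x i₀) ≠ 0 := fun h =>
    hx0 (IsFractionRing.injective R K (by rw [h, map_zero]))
  have hreg := isRegularRing_closure_of_isRegularRing_blowupChart (algebraMap R K) x i₀
    (IsFractionRing.injective R K) hx0' hB
  have heq : Subring.closure (((algebraMap R K).range : Set K) ∪
      Set.range fun j => algebraMap R K (x j) / algebraMap R K (x i₀)) =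
      (Algebra.adjoin R
        (Set.range fun j : Fin d => algebraMap R K (x j) / algebraMap R K (x i₀))).toSubring := by
    rw [Algebra.adjoin_eq_ring_closure, RingHom.coe_range]
  haveI := hreg
  exact IsRegularRing.of_ringEquiv (RingEquiv.subringCongr heq)

/-- **The strict-transform cover over a blow-up chart of a characteristic-`2` Morse point is
regular along the exceptional divisor** (second tooth of the Hirokado engine, `p = 2`): with the
data of `morse_dies_in_one_blowup_char_two`, `g = x_{i₀}² g₁` in the chart `R₁ = R[x_j/x_{i₀}]`,
and `R₁[T]/(T² - g₁)` is a regular local ring at every prime `P` with `x_{i₀} ∈ P ∩ R₁` — the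
derivation `D₁` with `D₁ g₁ ∉ P ∩ R₁` feeds the pointwise Jacobian criterion
`isRegularLocalRing_localModel_of_derivation` over the regular ring `R₁`. [folklore] -/
theorem isRegularLocalRing_cover_chart_of_morse_char_two : ∀ {R : Type u} [CommRing R] [IsRegularLocalRing R] [CharP R 2] {d : ℕ} (x : Fin d → R), Ideal.span (Set.range x) = IsLocalRing.maximalIdeal R → (d : WithBot ℕ∞) = ringKrullDim R → ∀ (D : Fin d → Derivation ℤ R R), (∀ i j, D i (x j) = if i = j then 1 else 0) → ∀ (g : R), g ∈ IsLocalRing.maximalIdeal R ^ 2 → IsUnit (Matrix.det (Matrix.of fun i j : Fin d => IsLocalRing.residue R (D i (D j g)))) → ∀ (K : Type u) [Field K] [Algebra R K] [IsFractionRing R K] (i₀ : Fin d) (R₁ : Subalgebra R K), R₁ = Algebra.adjoin R (Set.range fun j : Fin d => algebraMap R K (x j) / algebraMap R K (x i₀)) → ∃ g₁ : R₁, algebraMap R K g = algebraMap R K (x i₀) ^ 2 * (g₁ : K) ∧ ∀ (P : Ideal (AdjoinRoot ((Polynomial.X : Polynomial R₁) ^ 2 - Polynomial.C g₁))) [P.IsPrime],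 algebraMap R R₁ (x i₀) ∈ P.comap (AdjoinRoot.of ((Polynomial.X : Polynomial R₁) ^ 2 - Polynomial.C g₁)) → IsRegularLocalRing (Localization.AtPrime P) := by
  intro R _ _ _ d x hx hdim D hD g hg hdet K _ _ _ i₀ R₁ hR₁
  obtain ⟨g₁, hg₁, hder⟩ :=
    MorseCharTwo.morse_dies_in_one_blowup_char_two x hx hdim D hD g hg hdet K i₀ R₁ hR₁
  -- `x_{i₀} ≠ 0` (as `D_{i₀} x_{i₀} = 1`)
  have hx0 : x i₀ ≠ 0 := by
    intro h
    have h1 := hD i₀ i₀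
    rw [h, map_zero, if_pos rfl] at h1
    exact zero_ne_one h1
  -- the chart is a regular ring
  haveI : IsRegularRing R₁ := by
    rw [hR₁]
    exact isRegularRing_adjoin_chart x hx hdim K i₀ hx0
  refine ⟨g₁, hg₁, fun P _ hP => ?_⟩
  obtain ⟨D₁, hD₁⟩ := hder (P.comap (AdjoinRoot.of ((X : R₁[X]) ^ 2 - C g₁)))
    (Ideal.comap_isPrime _ P) hP
  exact isRegularLocalRing_localModel_of_derivation D₁ g₁ 2 P hD₁

end Summit.ResolutionOfSingularities.ResolutionOfSingularities.Theorems.Picover.MorseCharTwoCover
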